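import Summits.HubbardSuperconductivity.HubbardSuperconductivity.Theorems.MesoscopicPairOrder.Negative.StonerExactDoublon
import Literature.MathematicalPhysics.QuantumLattice.FreeFermionSectorGroundStates
import Literature.MathematicalPhysics.QuantumLattice.FinDimSpectrumSectorGibbsLimit
import HarnessLib

/-!
# Crux `NoOnsiteODLRO` (stmt-HubbardSuperconductivity-0933) — the Hartree–Fock energy ceiling
# `E_(2n,0)(U) ≤ E_(2n,0)(0) + U·n²/L²`

Helper file of line `Sketch` (lead c3) for the crux `NoOnsiteODLRO` (routes `LiebTwin`, `EnslavedA1g`),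
serving the registered by-product stub `stub_hartreeFockEnergyCeiling`: for the Hubbard torus
`hubbardTorus 2 L 1 U` (`L ≥ 3`, any real `U`) and every `n ≤ L²`, the ground energy of the joint
sector `(2n, S^z = 0)` is at most the FREE sector floor plus the exact Hartree–Fock interaction energy
`U·n²/L²` of a paired Fermi sea.

Proof: pick a Fermi set `F` of `n` lowest levels of the band `torusBand L`
(`Literature.MathematicalPhysics.QuantumLattice.exists_fermiSet`); the
paired Fermi sea `Φ_F = Π_{k∈F} b†_k |0⟩` is a unit vector of `szSector (2n) 0`
(`pairedState_mem_szSector`, `star_pairedState_dotProduct_self`) with energy EXACTLY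
`2Σ_{k∈F} ε_L(k) + U·n²/L²` (`re_expect_hubbardTorus_pairedState`), the free floor IS `2Σ_{k∈F} ε_L(k)`
(`minEnergyOn_szSector_free_eq`), and the variational principle (`minEnergyOn_le_rayleigh_of_mem`)
concludes.

Sources: D. R. Penn, Phys. Rev. 142 (1966) 350, §II; J. Bardeen, L. N. Cooper, J. R. Schrieffer,
Phys. Rev. 108 (1957) 1175, §II; E. H. Lieb, M. Loss, *Analysis* (AMS, 2001), Thm 1.14 (bathtub
principle). Folklore finite-dimensional statements on tree definitions; no definition and no named fact
is introduced.
-/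

noncomputable section

set_option linter.dupNamespace false

namespace Summit.HubbardSuperconductivity.HubbardSuperconductivity.Theorems.NoOnsiteODLRO.HartreeFock

open Matrix Finset
open Literature.Probability.LatticeModels Literature.MathematicalPhysics.QuantumLattice
open scoped ComplexOrder
open Summit.HubbardSuperconductivity.HubbardSuperconductivity.Theorems.MesoscopicPairOrder.Negative
  (re_expect_hubbardTorus_pairedState)

/-- **HARTREE–FOCK ENERGY CEILING** (hypothesis form): for `L ≥ 3`, any real `U` and `n ≤ L²`,
`E_(2n,0)(U) ≤ E_(2n,0)(0) + U·n²/L²` on the Hubbard torus `hubbardTorus 2 L 1 U` — the paired Fermi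
sea over `n` lowest band levels is a unit trial vector of the sector `(2n, S^z = 0)` whose energy is the
free floor plus `U·n²/L²`. Penn, Phys. Rev. 142 (1966) 350, §II; BCS (1957) §II; Lieb–Loss,
Analysis (2001) Thm 1.14. [folklore] -/
theorem hartreeFockEnergyCeiling {L : ℕ} [NeZero L] (hL : 3 ≤ L) (U : ℝ) {n : ℕ} (hn : n ≤ L ^ 2) :
    (hubbardTorus 2 L 1 U).minEnergyOn (szSector (Λ := FermionTorus 2 L) (2 * n) 0) ≤
      (hubbardTorus 2 L 1 0).minEnergyOn (szSector (Λ := FermionTorus 2 L) (2 * n) 0) +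
        U * ((n : ℝ) ^ 2 / (L : ℝ) ^ 2) := by
  have hn' : n ≤ Fintype.card (TorusSite 2 L) := by
    simpa [ZMod.card] using hn
  obtain ⟨F, eF, hcard, hF, hF'⟩ :=
    Literature.MathematicalPhysics.QuantumLattice.exists_fermiSet (torusBand L) hn'
  subst hcard
  set Φ : Fock (Orb (FermionTorus 2 L)) :=
    (List.prod (List.map (fun q : TorusSite 2 L => (pairMode q)ᴴ) F.toList)) *ᵥ
      (vacuum : Fock (Orb (FermionTorus 2 L))) with hΦ_def
  have hΦmem : Φ ∈ szSector (Λ := FermionTorus 2 L) (2 * F.card) 0 := by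
    rw [← F.length_toList]; exact pairedState_mem_szSector F.toList
  have hΦ1 : star Φ ⬝ᵥ Φ = 1 := star_pairedState_dotProduct_self F.nodup_toList
  have hH : (hubbardTorus 2 L 1 U).IsHermitian := LiebThm1.hamiltonian_isHermitian _ 1 U
  have hvar := minEnergyOn_le_rayleigh_of_mem hH _ hΦmem hΦ1
  rw [hΦ_def, re_expect_hubbardTorus_pairedState hL U F.nodup_toList F.length_toList,
    F.toList_toFinset] at hvar
  rw [minEnergyOn_szSector_free_eq hL F eF hF hF']
  exact hvar

/-- **`stub_hartreeFockEnergyCeiling`** (registered stub of crux `NoOnsiteODLRO`, line `Sketch`, in its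
exact registered form): for every `L ≥ 3`, real `U` and `n ≤ L²`,
`E_(2n,0)(hubbardTorus 2 L 1 U) ≤ E_(2n,0)(hubbardTorus 2 L 1 0) + U·n²/L²`
(`hartreeFockEnergyCeiling`). Penn, Phys. Rev. 142 (1966) 350, §II; BCS (1957) §II; Lieb–Loss,
Analysis (2001) Thm 1.14. [folklore] -/
theorem stub_hartreeFockEnergyCeiling :
    ∀ (L : ℕ) [NeZero L], 3 ≤ L → ∀ (U : ℝ) (n : ℕ), n ≤ L ^ 2 →
      (hubbardTorus 2 L 1 U).minEnergyOn (szSector (Λ := FermionTorus 2 L) (2 * n) 0) ≤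
        (hubbardTorus 2 L 1 0).minEnergyOn (szSector (Λ := FermionTorus 2 L) (2 * n) 0) +
          U * ((n : ℝ) ^ 2 / (L : ℝ) ^ 2) :=
  fun _ _ hL U _ hn => hartreeFockEnergyCeiling hL U hn

end Summit.HubbardSuperconductivity.HubbardSuperconductivity.Theorems.NoOnsiteODLRO.HartreeFock
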